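import Mathlib
import HarnessLib

/-!
# `NoHeavyLowerTail` (crux stmt-CriticalPhenomena-4575), antithetic vdBHK programme: mask-encoded finite orbit posets

Support file (seat `prim-ineq-gen-7` gen 41; `--supports stmt-CriticalPhenomena-4575`).  No `sorry`.  Memo: FINDING-AKORB-g41.md §6.

A second carrier for the explicit orbit posets of AK-orbit certificates, designed so that NO finite case analysis is needed for the order axioms:
element `a` carries the bit mask `M a` of its principal up-set inside the ambient position poset, and `a ≤ b :⟺ M b &&& M a = M b` (`↑b ⊆ ↑a`).
Reflexivity and transitivity are then identities of `Nat.land`, and every concrete order / comparability / antitonicity fact is a closed `Nat`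
computation (`decide`).  Companion of `AntitheticOrbitPoset` (Boolean order tables), whose `decide`d transitivity does not scale to 16-element orbits.
-/

namespace Summit.CriticalPhenomena.PercolationContinuityZ3.Theorems

open Finset

namespace AntitheticOrbitMask

/-- The carrier: a copy of `Fin k`, the order being read off the up-set masks `M`. -/
structure OrbM {k : ℕ} (M : Fin k → ℕ) where
  /-- the index of the element -/
  i : Fin k
deriving DecidableEq

variable {k : ℕ} {M : Fin k → ℕ}

/-- `a ≤ b` iff the up-set mask of `b` is contained in that of `a`. -/
instance : Preorder (OrbM M) where
  le a b := M b.i &&& M a.i = M b.i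
  le_refl a := Nat.and_self _
  le_trans a b c hab hbc := by
    change M b.i &&& M a.i = M b.i at hab
    change M c.i &&& M b.i = M c.i at hbc
    calc M c.i &&& M a.i = (M c.i &&& M b.i) &&& M a.i := by rw [hbc]
      _ = M c.i &&& (M b.i &&& M a.i) := by rw [Nat.land_assoc]
      _ = M c.i &&& M b.i := by rw [hab]
      _ = M c.i := hbc

/-- The order is a decidable `Nat` identity. -/
instance (a b : OrbM M) : Decidable (a ≤ b) := inferInstanceAs (Decidable (M b.i &&& M a.i = M b.i))

/-- `OrbM M` is `Fin k` in disguise. -/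
def equivFin (M : Fin k → ℕ) : Fin k ≃ OrbM M where
  toFun i := ⟨i⟩
  invFun r := r.i
  left_inv _ := rfl
  right_inv _ := rfl

/-- `OrbM M` is finite. -/
instance : Fintype (OrbM M) := Fintype.ofEquiv (Fin k) (equivFin M)

/-- The order unfolds to the mask identity. -/
theorem le_iff (a b : OrbM M) : a ≤ b ↔ M b.i &&& M a.i = M b.i := Iff.rfl

/-- Sums over `OrbM M` are sums over `Fin k`. -/
theorem sum_orb {A : Type*} [AddCommMonoid A] (f : OrbM M → A) : ∑ r : OrbM M, f r = ∑ i : Fin k, f ⟨i⟩ :=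
  (Equiv.sum_comp (equivFin M) f).symm

/-- A table-defined self-map. -/
def tmap (t : Fin k → Fin k) : OrbM M → OrbM M := fun r => ⟨t r.i⟩

/-- Index of a table-mapped element. -/
@[simp] theorem tmap_i (t : Fin k → Fin k) (r : OrbM M) : (tmap (M := M) t r).i = t r.i := rfl

/-- A table-defined involution as an `Equiv`. -/
def tinv (t : Fin k → Fin k) (ht : ∀ i, t (t i) = i) : OrbM M ≃ OrbM M where
  toFun := tmap t
  invFun := tmap t
  left_inv r := by cases r; simp [tmap, ht]
  right_inv r := by cases r; simp [tmap, ht]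

/-- `tinv` unfolds to the table. -/
@[simp] theorem tinv_apply (t : Fin k → Fin k) (ht : ∀ i, t (t i) = i) (r : OrbM M) : tinv (M := M) t ht r = ⟨t r.i⟩ := rfl

/-- `tinv` is an involution. -/
theorem tinv_tinv (t : Fin k → Fin k) (ht : ∀ i, t (t i) = i) (r : OrbM M) : tinv (M := M) t ht (tinv t ht r) = r := by
  cases r; simp [ht]

/-- Comparability of every element with its partner, read off the masks. -/
theorem tinv_comparable (t : Fin k → Fin k) (ht : ∀ i, t (t i) = i)
    (hc : ∀ i, M (t i) &&& M i = M (t i) ∨ M i &&& M (t i) = M i) (r : OrbM M) :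
    r ≤ tinv t ht r ∨ tinv t ht r ≤ r := by
  cases r with
  | mk i => simpa [le_iff] using hc i

/-- Antitonicity of a table map, read off the masks. -/
theorem tmap_anti (t : Fin k → Fin k) (ha : ∀ a b : Fin k, M b &&& M a = M b → M (t a) &&& M (t b) = M (t a)) :
    ∀ r r' : OrbM M, r ≤ r' → tmap (M := M) t r' ≤ tmap t r := by
  rintro ⟨a⟩ ⟨b⟩ h; exact ha a b h

/-- Monotonicity of a table-indexed family of finsets. -/
theorem fam_mono {β : Type*} (F : Fin k → Finset β) (hF : ∀ a b : Fin k, M b &&& M a = M b → F a ⊆ F b) :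
    ∀ r r' : OrbM M, r ≤ r' → F r.i ⊆ F r'.i := by
  rintro ⟨a⟩ ⟨b⟩ h; exact hF a b h

end AntitheticOrbitMask

end Summit.CriticalPhenomena.PercolationContinuityZ3.Theorems
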